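import Literature.AnabelianGeometry.EtaleTheta.Discharge.Sec5Prop55OfConnectedTemperoidDataOfPin
import Literature.AnabelianGeometry.EtaleTheta.Discharge.Sec5RootCocycleDiesOfDictionary

/-!
# [EtTh] Prop. 5.5 over `B^temp(Π^tp_X)⁰` with Prop. 5.2 (iii) entering ONCE, as the cocycle-level dictionary F-0521 — at abc-iut-L2-t4's
# assembled data over the connected base and at the GENUINE data `ofConnectedTemperoidData` (Prop. 5.5 pp.327–328, Prop. 5.2 (iii) p.324 / PDF pp.101–102, 98)

Mochizuki, *The étale theta function and its Frobenioid-theoretic manifestations*, Publ. RIMS **45** (2009)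
[cite: MochizukiEtTh2009, Prop 5.5 p.327–328 (PDF pp.101–102); Prop 5.2 (iii) p.324 (PDF p.98)].
Layer L2 of the abc-iut cell, seat abc-iut-L6-t23 (gen 5); offer O-L6t23-A (sequel of abc-iut-L2-lead R166).  PROOF-ONLY (no definition,
no named fact; nothing landed is edited): a BY-NAME composition of abc-iut-w4-d099's `cyclotomicRigidity_ofBiKummerData_connectedPart_of_pin` /
`cyclotomicRigidity_ofConnectedTemperoidData_of_pin` (`Sec5Prop55OfConnectedTemperoidDataOfPin.lean`) with the two producers that make the
`(η, ν)`-PIN binders consequences of the F-0521 dictionary: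
* `hdies` («the mod-`N` theta cocycle dies on `Ker ρ ∩ Π^tp_Ÿ̲̲`», GAP G-w5d123-1) := this seat's
  `hdies_ofBiKummerData_of_thetaSectionCompat` (`Sec5RootCocycleDiesOfDictionary.lean`: the bi-Kummer difference cocycle factors through `ρ`);
* `hK` (abc-iut-L2-t4's class-level pin `ThetaPairKummerClass 𝔉 η ν` for every `η` on `H_{B_N}` descending `η₀` through `e`) :=
  abc-iut-w4-d099's converse `thetaPairKummerClass_of_thetaSectionCompat` (`u := 1`), the pin `m ∘ ν ∘ η ∘ ρ = η₀` coming from the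
  descent equation and the normalisation `hme : m ∘ ν ∘ e = id`.
RESULT: `cyclotomicRigidity_ofBiKummerData_connectedPart_of_thetaSectionCompat` / `cyclotomicRigidity_ofConnectedTemperoidData_of_thetaSectionCompat`
— [EtTh] Prop. 5.5 (`CyclotomicRigidity 𝔉 P hB`) at the data over `B^temp(Π^tp_X)⁰` resp. at the GENUINE data, where the Prop. 5.2 (iii)
input is the SINGLE cocycle-level binder `hcompat : ThetaSectionCompat H RD id m _ η₀` (with `η₀ ∈ thetaCocycles`).  By abc-iut-f-116's
`exists_thetaSectionCompat_mem_iff` its content is ONE membership statement — «the `m`-transport of the bi-Kummer difference cocycle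
`s^⊔-gp_N(ρ ·) · s^⊓-gp_N(ρ ·)⁻¹` on `Π^tp_Ÿ̲̲` lies in the mod-`N` étale theta class `η̲̈^Θ`» — which is what the genuine sections
`s_N, τ_N` (Prop. 1.1, Lemma 1.2; W3-L2-01) must eventually supply; `hdies` and the class-form pin are no longer separate inputs.
Residual binder list (genuine data): `hB P H m hχX hη₀ hcompat e he hlift hpre hPproj ν hme hgeom hconst hreach hLc hLi hproj`
(abc-iut-w4-d099's list minus `{hdies, hK}`, plus `hcompat`); and `…_of_cov`: the same with abc-iut-L2-t4's single coverage binder `hcov'`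
(as in `exists_rigidityFamily_unique_preserved_ofConnectedTemperoidData`) supplying both `hlift` and — via `RigidData.lDeltaTheta_le`
(`l·Δ_Θ ≤ Ker aug`) — `hgeom`.
HONEST FRAMING: kernel-checked composition of typed statements; the dictionary (`hcompat`, `hχX`), `Facts`, the subquotient laws and the
transport inputs remain hypotheses to be instantiated; nothing of [EtTh] is asserted unconditionally; typed ≠ proved; no side is taken on
anything downstream ([IUTchIII] Cor. 3.12).
-/

noncomputable section

namespace Literature.AnabelianGeometry.EtaleTheta

open CategoryTheory Opposite FrobenioidCyclotomicRigidity Literature.AlgebraicGeometry.Frobenioids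
  Literature.AnabelianGeometry.SemiGraphs

universe u₀ v₀ w

namespace ThetaFrobenioid

/-! ### Over any §4 setting on the connected base `B^temp(Π^tp_X)⁰` -/

section ConnectedPart

variable {K : Type u₀} [Field K] {X : SemiGraphs.TemperedArithmeticGroup.{u₀} K} {D₀ : Type u₀} [Category.{v₀} D₀]
  {V : FrdIMonoidStub.{w}} {T₀ : RealifiedDivisorMonoids (D₀ := D₀) V}
  {VD : FrdICatStub.{u₀ + 1, u₀, w} (ConnectedPart (BTemp X.Pi))} {S : BiKummerSetting X T₀ (ConnectedPart (BTemp X.Pi)) VD}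
  {pullFrac : ∀ {A A' : S.C} (_ : A' ⟶ A), S.biratUnits A → S.biratUnits A'}
  {lv N : ℕ+} {l' : ℕ} {RD : RigidData.{max u₀ w} N l'} {θ : S.biratUnits S.Aodot} {Bl : S.C}
  {Pl : S.FractionPair θ Bl} {Rl : S.NthRoot θ Pl lv pullFrac}
  (h : ModelFrobenioid.Hypotheses S.tf.divisorMonoid S.tf.ratFnFunctor)
  (toB : ∀ A : S.C, S.biratUnits A →* S.tf.biratUnitsModel A)
  (Q : FrobenioidTheta.ThetaSubquotientStub.{w} (ConnectedPart (BTemp X.Pi)))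
  (odd_l : Odd (lv : ℕ)) (R : S.NthRoot Rl.root Rl.pair N pullFrac) (ιX : RD.PiX ≃ₜ* X.Pi)
  (hopen : IsOpen ((S.galoisSurj R.AN.base R.αData.isGalois).ker : Set X.Pi)) (σ : Aut R.AN.base →* Aut R.AN)
  (K' : Type w) [Field K'] (constEmb : K'ˣ →* S.tf.biratUnitsModel R.BN)
  (constEmb_injective : Function.Injective constEmb)
  (hdivc : ∀ g : Aut R.BN.base,
    ModelFrobenioid.div ((σ ((BiKummerSetting.NthRoot.baseIso S R).conjAut.symm g)).hom ≫ R.pair.num) =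
      ModelFrobenioid.div R.pair.num)
  (hdivp : ∀ y : RD.PiYdd,
    ModelFrobenioid.div ((σ (S.galoisSurj R.AN.base R.αData.isGalois (ιX y.1))).hom ≫ R.pair.den) =
      ModelFrobenioid.div R.pair.den)

/-- **[EtTh] Proposition 5.5 for the §5 data over `B^temp(Π^tp_X)⁰` with Prop. 5.2 (iii) entering ONCE** (abc-iut-w4-d099's
`cyclotomicRigidity_ofBiKummerData_connectedPart_of_pin` with `hdies := hdies_ofBiKummerData_of_thetaSectionCompat` and the class-form pin
`hK := thetaPairKummerClass_of_thetaSectionCompat`): the Prop. 5.2 (iii) input is the single cocycle-level dictionary `hcompat` for `η₀`.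
[cite: MochizukiEtTh2009, Prop 5.5 p.327–328 (PDF pp.101–102); Prop 5.2 (iii) p.324 (PDF p.98)] -/
theorem cyclotomicRigidity_ofBiKummerData_connectedPart_of_thetaSectionCompat
    (hIG : ∀ A : ConnectedPart (BTemp X.Pi), S.IsGaloisObj A → SemiGraphs.IsGaloisObj A.obj)
    (hB : (ofBiKummerData h toB Q odd_l R ιX hopen σ K' constEmb constEmb_injective hdivc hdivp).IsThetaSaturated
      (ofBiKummerData h toB Q odd_l R ιX hopen σ K' constEmb constEmb_injective hdivc hdivp).BN)
    (P : ThetaSubquotientProj (ofBiKummerData h toB Q odd_l R ιX hopen σ K' constEmb constEmb_injective hdivc hdivp))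
    (H : (ofBiKummerData h toB Q odd_l R ιX hopen σ K' constEmb constEmb_injective hdivc hdivp).Facts)
    (m : (ofBiKummerData h toB Q odd_l R ιX hopen σ K' constEmb constEmb_injective hdivc hdivp).muTorsion
        (ofBiKummerData h toB Q odd_l R ιX hopen σ K' constEmb constEmb_injective hdivc hdivp).BN
        (ofBiKummerData h toB Q odd_l R ιX hopen σ K' constEmb constEmb_injective hdivc hdivp).N ≃* RD.mu)
    (hχX : (ofBiKummerData h toB Q odd_l R ιX hopen σ K' constEmb constEmb_injective hdivc hdivp).CyclotomicCharacterCompatX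
      RD.toThetaEnvData (MulEquiv.refl _) m)
    {η₀ : RD.PiYdd → RD.mu} (hη₀ : η₀ ∈ RD.thetaCocycles)
    (hcompat : (ofBiKummerData h toB Q odd_l R ιX hopen σ K' constEmb constEmb_injective hdivc hdivp).ThetaSectionCompat H
      RD.toThetaEnvData (MulEquiv.refl _) m (fun _ => Iff.rfl) η₀)
    (e : RD.mu → (ofBiKummerData h toB Q odd_l R ιX hopen σ K' constEmb constEmb_injective hdivc hdivp).lDeltaModN
      (ofBiKummerData h toB Q odd_l R ιX hopen σ K' constEmb constEmb_injective hdivc hdivp).BN)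
    (he : Function.Surjective e)
    (hlift : ∀ a ∈ (ofBiKummerData h toB Q odd_l R ιX hopen σ K' constEmb constEmb_injective hdivc hdivp).HB,
      a ∈ P.pre _ → ∃ k : RD.PiYdd, (k : RD.PiX) ∈ RD.lDeltaTheta ∧ rhoOfBiKummerData R ιX k = a)
    (hpre : ∀ k : RD.PiYdd, (k : RD.PiX) ∈ RD.lDeltaTheta → rhoOfBiKummerData R ιX k ∈ P.pre _)
    (hP : ∀ (k : RD.PiYdd) (hk : (k : RD.PiX) ∈ RD.lDeltaTheta) (hm : rhoOfBiKummerData R ιX k ∈ P.pre _),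
      (QuotientGroup.mk (P.proj _ ⟨rhoOfBiKummerData R ιX k, hm⟩) :
          (ofBiKummerData h toB Q odd_l R ιX hopen σ K' constEmb constEmb_injective hdivc hdivp).lDeltaModN
            (ofBiKummerData h toB Q odd_l R ιX hopen σ K' constEmb constEmb_injective hdivc hdivp).BN) =
        e (RD.thetaMod ⟨k, hk⟩))
    (ν : (ofBiKummerData h toB Q odd_l R ιX hopen σ K' constEmb constEmb_injective hdivc hdivp).lDeltaModN
        (ofBiKummerData h toB Q odd_l R ιX hopen σ K' constEmb constEmb_injective hdivc hdivp).BN ≃*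
      (ofBiKummerData h toB Q odd_l R ιX hopen σ K' constEmb constEmb_injective hdivc hdivp).muTorsion
        (ofBiKummerData h toB Q odd_l R ιX hopen σ K' constEmb constEmb_injective hdivc hdivp).BN
        (ofBiKummerData h toB Q odd_l R ιX hopen σ K' constEmb constEmb_injective hdivc hdivp).N)
    (hme : ∀ x : RD.mu, m (ν (e x)) = x)
    (hσ : ∀ g : Aut R.AN.base, ModelFrobenioid.baseMap (σ g).hom = g.hom)
    (hgeom : P.pre R.BN.base ≤ RD.aug.ker.map (rhoOfBiKummerData R ιX))
    (hconst : ∀ δ ∈ RD.aug.ker, ∀ τ : ModelFrobenioid.units R.BN,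
      (S.tf.ratFnFunctor.map (rhoOfBiKummerData R ιX δ).hom.op).hom (ModelFrobenioid.unit τ.1.hom) =
        ModelFrobenioid.unit τ.1.hom)
    (hreach : LinearlyReachableFromBN
      (ofBiKummerData h toB Q odd_l R ιX hopen σ K' constEmb constEmb_injective hdivc hdivp))
    (hLc : Thm56Sub.LDeltaMapComp
      (ofBiKummerData h toB Q odd_l R ιX hopen σ K' constEmb constEmb_injective hdivc hdivp))
    (hLi : Thm56Sub.LDeltaMapId
      (ofBiKummerData h toB Q odd_l R ιX hopen σ K' constEmb constEmb_injective hdivc hdivp))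
    (hproj : ∀ (g g' : Aut ((ofBiKummerData h toB Q odd_l R ιX hopen σ K' constEmb constEmb_injective hdivc hdivp).base.obj
        (ofBiKummerData h toB Q odd_l R ιX hopen σ K' constEmb constEmb_injective hdivc hdivp).BN))
        (hh : g' ∈ P.pre _), ∃ hgh : g * g' * g⁻¹ ∈ P.pre _,
          (ofBiKummerData h toB Q odd_l R ιX hopen σ K' constEmb constEmb_injective hdivc hdivp).lDeltaMap g.hom
              (P.proj _ ⟨g', hh⟩) = P.proj _ ⟨g * g' * g⁻¹, hgh⟩) :
    CyclotomicRigidity (ofBiKummerData h toB Q odd_l R ιX hopen σ K' constEmb constEmb_injective hdivc hdivp) P hB :=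
  cyclotomicRigidity_ofBiKummerData_connectedPart_of_pin h toB Q odd_l R ιX hopen σ K' constEmb constEmb_injective hdivc hdivp hIG hB P H m
    hχX hη₀
    (hdies_ofBiKummerData_of_thetaSectionCompat h toB Q odd_l R ιX hopen σ K' constEmb constEmb_injective hdivc hdivp H m
      (fun _ => Iff.rfl) hcompat)
    e he hlift hpre hP ν hme
    (fun η hη =>
      (ofBiKummerData h toB Q odd_l R ιX hopen σ K' constEmb constEmb_injective hdivc hdivp).thetaPairKummerClass_of_thetaSectionCompat
        RD H (MulEquiv.refl _) m (fun _ => Iff.rfl) hcompat ν η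
        (fun k => (congrArg (fun z => m (ν z)) (hη k)).trans (hme (η₀ k))))
    hσ hgeom hconst hreach hLc hLi hproj

end ConnectedPart

/-! ### At the GENUINE connected data `ofConnectedTemperoidData` -/

section OfConnectedTemperoidData

open Literature.AlgebraicGeometry.Frobenioids.QuasiTemperoid.BTempConnected

variable {K : Type u₀} [Field K] {X : SemiGraphs.TemperedArithmeticGroup.{u₀} K} {D₀ : Type u₀} [Category.{v₀} D₀]
  {V : FrdIMonoidStub.{w}} {T₀ : RealifiedDivisorMonoids (D₀ := D₀) V}
  {VD : FrdICatStub.{u₀ + 1, u₀, w} (ConnectedPart (BTemp X.Pi))}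
  {tf : TemperedFrobenioid T₀ (ConnectedPart (BTemp X.Pi)) VD} {hZ : tf.monoidType = MonoidType.Z}
  {hP : ∀ A : (ConnectedPart (BTemp X.Pi))ᵒᵖ, IsPerfect (tf.Φ.carrier A)}
  {NH : Subgroup (Field.absoluteGaloisGroup K) → tf.category → ℕ+ → Prop} {A₀ : tf.category}
  {hA₀ : PreFrobenioid.IsFrobeniusTrivial tf.toElem A₀} {hA₀' : SemiGraphs.IsGaloisObj A₀.base.obj}
  {pullFrac : ∀ {A A' : (BiKummerSetting.mkOfConnectedTemperoid X tf hZ hP NH A₀ hA₀ hA₀').C} (_ : A' ⟶ A),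
    (BiKummerSetting.mkOfConnectedTemperoid X tf hZ hP NH A₀ hA₀ hA₀').biratUnits A →
      (BiKummerSetting.mkOfConnectedTemperoid X tf hZ hP NH A₀ hA₀ hA₀').biratUnits A'}
  {lv N : ℕ+} {l' : ℕ} {RD : RigidData.{max u₀ w} N l'}
  {θ : (BiKummerSetting.mkOfConnectedTemperoid X tf hZ hP NH A₀ hA₀ hA₀').biratUnits
    (BiKummerSetting.mkOfConnectedTemperoid X tf hZ hP NH A₀ hA₀ hA₀').Aodot}
  {Bl : (BiKummerSetting.mkOfConnectedTemperoid X tf hZ hP NH A₀ hA₀ hA₀').C}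
  {Pl : (BiKummerSetting.mkOfConnectedTemperoid X tf hZ hP NH A₀ hA₀ hA₀').FractionPair θ Bl}
  {Rl : (BiKummerSetting.mkOfConnectedTemperoid X tf hZ hP NH A₀ hA₀ hA₀').NthRoot θ Pl lv pullFrac}
  (h : ModelFrobenioid.Hypotheses tf.divisorMonoid tf.ratFnFunctor)
  (Q : FrobenioidTheta.ThetaSubquotientStub.{w} (ConnectedPart (BTemp X.Pi))) (odd_l : Odd (lv : ℕ))
  (R : (BiKummerSetting.mkOfConnectedTemperoid X tf hZ hP NH A₀ hA₀ hA₀').NthRoot Rl.root Rl.pair N pullFrac)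
  (ιX : RD.PiX ≃ₜ* X.Pi) (K' : Type w) [Field K'] (constEmb : K'ˣ →* tf.biratUnitsModel R.BN)
  (constEmb_injective : Function.Injective constEmb)
  (hinvc : ∀ g : Aut R.AN.base,
    pull tf.divisorMonoid g.hom (ModelFrobenioid.div R.pair.num) = ModelFrobenioid.div R.pair.num)
  (hinvp : ∀ y : RD.PiX, y ∈ RD.PiYdd →
    pull tf.divisorMonoid ((BiKummerSetting.mkOfConnectedTemperoid X tf hZ hP NH A₀ hA₀ hA₀').galoisSurj R.AN.base
      R.αData.isGalois (ιX y)).hom (ModelFrobenioid.div R.pair.den) = ModelFrobenioid.div R.pair.den)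

/-- **[EtTh] Proposition 5.5 for the GENUINE §5 data over `B^temp(Π^tp_X)⁰` with Prop. 5.2 (iii) entering ONCE** — abc-iut-w4-d099's
`cyclotomicRigidity_ofConnectedTemperoidData_of_pin` with the pin binders `hdies`, `hK` PRODUCED from the cocycle-level dictionary
`hcompat : ThetaSectionCompat H RD id m _ η₀` (this seat's `hdies_ofBiKummerData_of_thetaSectionCompat`, abc-iut-w4-d099's
`thetaPairKummerClass_of_thetaSectionCompat`).  Residual binders: `hB P H m hχX hη₀ hcompat e he hlift hpre hPproj ν hme hgeom hconst hreach
hLc hLi hproj`.  [cite: MochizukiEtTh2009, Prop 5.5 p.327–328 (PDF pp.101–102); Prop 5.2 (iii) p.324 (PDF p.98)] -/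
theorem cyclotomicRigidity_ofConnectedTemperoidData_of_thetaSectionCompat
    (hB : (ofConnectedTemperoidData h Q odd_l R ιX K' constEmb constEmb_injective hinvc hinvp).IsThetaSaturated
      (ofConnectedTemperoidData h Q odd_l R ιX K' constEmb constEmb_injective hinvc hinvp).BN)
    (P : ThetaSubquotientProj (ofConnectedTemperoidData h Q odd_l R ιX K' constEmb constEmb_injective hinvc hinvp))
    (H : (ofConnectedTemperoidData h Q odd_l R ιX K' constEmb constEmb_injective hinvc hinvp).Facts)
    (m : (ofConnectedTemperoidData h Q odd_l R ιX K' constEmb constEmb_injective hinvc hinvp).muTorsion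
        (ofConnectedTemperoidData h Q odd_l R ιX K' constEmb constEmb_injective hinvc hinvp).BN
        (ofConnectedTemperoidData h Q odd_l R ιX K' constEmb constEmb_injective hinvc hinvp).N ≃* RD.mu)
    (hχX : (ofConnectedTemperoidData h Q odd_l R ιX K' constEmb constEmb_injective hinvc hinvp).CyclotomicCharacterCompatX
      RD.toThetaEnvData (MulEquiv.refl _) m)
    {η₀ : RD.PiYdd → RD.mu} (hη₀ : η₀ ∈ RD.thetaCocycles)
    (hcompat : (ofConnectedTemperoidData h Q odd_l R ιX K' constEmb constEmb_injective hinvc hinvp).ThetaSectionCompat H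
      RD.toThetaEnvData (MulEquiv.refl _) m (fun _ => Iff.rfl) η₀)
    (e : RD.mu → (ofConnectedTemperoidData h Q odd_l R ιX K' constEmb constEmb_injective hinvc hinvp).lDeltaModN
      (ofConnectedTemperoidData h Q odd_l R ιX K' constEmb constEmb_injective hinvc hinvp).BN)
    (he : Function.Surjective e)
    (hlift : ∀ a ∈ (ofConnectedTemperoidData h Q odd_l R ιX K' constEmb constEmb_injective hinvc hinvp).HB,
      a ∈ P.pre _ → ∃ k : RD.PiYdd, (k : RD.PiX) ∈ RD.lDeltaTheta ∧ rhoOfBiKummerData R ιX k = a)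
    (hpre : ∀ k : RD.PiYdd, (k : RD.PiX) ∈ RD.lDeltaTheta → rhoOfBiKummerData R ιX k ∈ P.pre _)
    (hPproj : ∀ (k : RD.PiYdd) (hk : (k : RD.PiX) ∈ RD.lDeltaTheta) (hm : rhoOfBiKummerData R ιX k ∈ P.pre _),
      (QuotientGroup.mk (P.proj _ ⟨rhoOfBiKummerData R ιX k, hm⟩) :
          (ofConnectedTemperoidData h Q odd_l R ιX K' constEmb constEmb_injective hinvc hinvp).lDeltaModN
            (ofConnectedTemperoidData h Q odd_l R ιX K' constEmb constEmb_injective hinvc hinvp).BN) =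
        e (RD.thetaMod ⟨k, hk⟩))
    (ν : (ofConnectedTemperoidData h Q odd_l R ιX K' constEmb constEmb_injective hinvc hinvp).lDeltaModN
        (ofConnectedTemperoidData h Q odd_l R ιX K' constEmb constEmb_injective hinvc hinvp).BN ≃*
      (ofConnectedTemperoidData h Q odd_l R ιX K' constEmb constEmb_injective hinvc hinvp).muTorsion
        (ofConnectedTemperoidData h Q odd_l R ιX K' constEmb constEmb_injective hinvc hinvp).BN
        (ofConnectedTemperoidData h Q odd_l R ιX K' constEmb constEmb_injective hinvc hinvp).N)
    (hme : ∀ x : RD.mu, m (ν (e x)) = x)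
    (hgeom : P.pre R.BN.base ≤ RD.aug.ker.map (rhoOfBiKummerData R ιX))
    (hconst : ∀ δ ∈ RD.aug.ker, ∀ τ : ModelFrobenioid.units R.BN,
      (tf.ratFnFunctor.map (rhoOfBiKummerData R ιX δ).hom.op).hom (ModelFrobenioid.unit τ.1.hom) =
        ModelFrobenioid.unit τ.1.hom)
    (hreach : LinearlyReachableFromBN
      (ofConnectedTemperoidData h Q odd_l R ιX K' constEmb constEmb_injective hinvc hinvp))
    (hLc : Thm56Sub.LDeltaMapComp
      (ofConnectedTemperoidData h Q odd_l R ιX K' constEmb constEmb_injective hinvc hinvp))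
    (hLi : Thm56Sub.LDeltaMapId
      (ofConnectedTemperoidData h Q odd_l R ιX K' constEmb constEmb_injective hinvc hinvp))
    (hproj : ∀ (g g' : Aut ((ofConnectedTemperoidData h Q odd_l R ιX K' constEmb constEmb_injective hinvc hinvp).base.obj
        (ofConnectedTemperoidData h Q odd_l R ιX K' constEmb constEmb_injective hinvc hinvp).BN))
        (hh : g' ∈ P.pre _), ∃ hgh : g * g' * g⁻¹ ∈ P.pre _,
          (ofConnectedTemperoidData h Q odd_l R ιX K' constEmb constEmb_injective hinvc hinvp).lDeltaMap g.hom
              (P.proj _ ⟨g', hh⟩) = P.proj _ ⟨g * g' * g⁻¹, hgh⟩) :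
    CyclotomicRigidity (ofConnectedTemperoidData h Q odd_l R ιX K' constEmb constEmb_injective hinvc hinvp) P hB :=
  cyclotomicRigidity_ofConnectedTemperoidData_of_pin h Q odd_l R ιX K' constEmb constEmb_injective hinvc hinvp hB P H m hχX hη₀
    (hdies_ofConnectedTemperoidData_of_thetaSectionCompat h Q odd_l R ιX K' constEmb constEmb_injective hinvc hinvp H m
      (fun _ => Iff.rfl) hcompat)
    e he hlift hpre hPproj ν hme
    (fun η hη =>
      (ofConnectedTemperoidData h Q odd_l R ιX K' constEmb constEmb_injective hinvc hinvp).thetaPairKummerClass_of_thetaSectionCompat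
        RD H (MulEquiv.refl _) m (fun _ => Iff.rfl) hcompat ν η
        (fun k => (congrArg (fun z => m (ν z)) (hη k)).trans (hme (η₀ k))))
    hgeom hconst hreach hLc hLi hproj


/-- **The same with the coverage in abc-iut-L2-t4's `hcov'` form** (every element of the `(l·Δ_Θ)_{B_N}`-part `P.pre` of `Aut_D(B_N^bs)` lifts
to `Π^tp_Ÿ̲̲ ∩ l·Δ_Θ` — the binder of `exists_rigidityFamily_unique_preserved_ofConnectedTemperoidData`): it supplies BOTH `hlift` and, since
`l·Δ_Θ ≤ Ker(aug)` (abc-iut-L2-t2's `RigidData.lDeltaTheta_le`: `Δ_Θ` is geometric), `hgeom` — so the Prop. 5.5 and Thm. 5.6 closers at the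
genuine data share one coverage binder.  [cite: MochizukiEtTh2009, Prop 5.5 p.327–328 (PDF pp.101–102); §2 p.272 (PDF p.46)] -/
theorem cyclotomicRigidity_ofConnectedTemperoidData_of_thetaSectionCompat_of_cov
    (hB : (ofConnectedTemperoidData h Q odd_l R ιX K' constEmb constEmb_injective hinvc hinvp).IsThetaSaturated
      (ofConnectedTemperoidData h Q odd_l R ιX K' constEmb constEmb_injective hinvc hinvp).BN)
    (P : ThetaSubquotientProj (ofConnectedTemperoidData h Q odd_l R ιX K' constEmb constEmb_injective hinvc hinvp))
    (H : (ofConnectedTemperoidData h Q odd_l R ιX K' constEmb constEmb_injective hinvc hinvp).Facts)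
    (m : (ofConnectedTemperoidData h Q odd_l R ιX K' constEmb constEmb_injective hinvc hinvp).muTorsion
        (ofConnectedTemperoidData h Q odd_l R ιX K' constEmb constEmb_injective hinvc hinvp).BN
        (ofConnectedTemperoidData h Q odd_l R ιX K' constEmb constEmb_injective hinvc hinvp).N ≃* RD.mu)
    (hχX : (ofConnectedTemperoidData h Q odd_l R ιX K' constEmb constEmb_injective hinvc hinvp).CyclotomicCharacterCompatX
      RD.toThetaEnvData (MulEquiv.refl _) m)
    {η₀ : RD.PiYdd → RD.mu} (hη₀ : η₀ ∈ RD.thetaCocycles)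
    (hcompat : (ofConnectedTemperoidData h Q odd_l R ιX K' constEmb constEmb_injective hinvc hinvp).ThetaSectionCompat H
      RD.toThetaEnvData (MulEquiv.refl _) m (fun _ => Iff.rfl) η₀)
    (e : RD.mu → (ofConnectedTemperoidData h Q odd_l R ιX K' constEmb constEmb_injective hinvc hinvp).lDeltaModN
      (ofConnectedTemperoidData h Q odd_l R ιX K' constEmb constEmb_injective hinvc hinvp).BN)
    (he : Function.Surjective e)
    (hcov' : ∀ g ∈ P.pre ((ofConnectedTemperoidData h Q odd_l R ιX K' constEmb constEmb_injective hinvc hinvp).base.obj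
        (ofConnectedTemperoidData h Q odd_l R ιX K' constEmb constEmb_injective hinvc hinvp).BN),
      ∃ k : RD.PiYdd, (k : RD.PiX) ∈ RD.lDeltaTheta ∧ rhoOfBiKummerData R ιX k = g)
    (hpre : ∀ k : RD.PiYdd, (k : RD.PiX) ∈ RD.lDeltaTheta → rhoOfBiKummerData R ιX k ∈ P.pre _)
    (hPproj : ∀ (k : RD.PiYdd) (hk : (k : RD.PiX) ∈ RD.lDeltaTheta) (hm : rhoOfBiKummerData R ιX k ∈ P.pre _),
      (QuotientGroup.mk (P.proj _ ⟨rhoOfBiKummerData R ιX k, hm⟩) :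
          (ofConnectedTemperoidData h Q odd_l R ιX K' constEmb constEmb_injective hinvc hinvp).lDeltaModN
            (ofConnectedTemperoidData h Q odd_l R ιX K' constEmb constEmb_injective hinvc hinvp).BN) =
        e (RD.thetaMod ⟨k, hk⟩))
    (ν : (ofConnectedTemperoidData h Q odd_l R ιX K' constEmb constEmb_injective hinvc hinvp).lDeltaModN
        (ofConnectedTemperoidData h Q odd_l R ιX K' constEmb constEmb_injective hinvc hinvp).BN ≃*
      (ofConnectedTemperoidData h Q odd_l R ιX K' constEmb constEmb_injective hinvc hinvp).muTorsion
        (ofConnectedTemperoidData h Q odd_l R ιX K' constEmb constEmb_injective hinvc hinvp).BN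
        (ofConnectedTemperoidData h Q odd_l R ιX K' constEmb constEmb_injective hinvc hinvp).N)
    (hme : ∀ x : RD.mu, m (ν (e x)) = x)
    (hconst : ∀ δ ∈ RD.aug.ker, ∀ τ : ModelFrobenioid.units R.BN,
      (tf.ratFnFunctor.map (rhoOfBiKummerData R ιX δ).hom.op).hom (ModelFrobenioid.unit τ.1.hom) =
        ModelFrobenioid.unit τ.1.hom)
    (hreach : LinearlyReachableFromBN
      (ofConnectedTemperoidData h Q odd_l R ιX K' constEmb constEmb_injective hinvc hinvp))
    (hLc : Thm56Sub.LDeltaMapComp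
      (ofConnectedTemperoidData h Q odd_l R ιX K' constEmb constEmb_injective hinvc hinvp))
    (hLi : Thm56Sub.LDeltaMapId
      (ofConnectedTemperoidData h Q odd_l R ιX K' constEmb constEmb_injective hinvc hinvp))
    (hproj : ∀ (g g' : Aut ((ofConnectedTemperoidData h Q odd_l R ιX K' constEmb constEmb_injective hinvc hinvp).base.obj
        (ofConnectedTemperoidData h Q odd_l R ιX K' constEmb constEmb_injective hinvc hinvp).BN))
        (hh : g' ∈ P.pre _), ∃ hgh : g * g' * g⁻¹ ∈ P.pre _,
          (ofConnectedTemperoidData h Q odd_l R ιX K' constEmb constEmb_injective hinvc hinvp).lDeltaMap g.hom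
              (P.proj _ ⟨g', hh⟩) = P.proj _ ⟨g * g' * g⁻¹, hgh⟩) :
    CyclotomicRigidity (ofConnectedTemperoidData h Q odd_l R ιX K' constEmb constEmb_injective hinvc hinvp) P hB :=
  cyclotomicRigidity_ofConnectedTemperoidData_of_thetaSectionCompat h Q odd_l R ιX K' constEmb constEmb_injective hinvc hinvp hB P H m
    hχX hη₀ hcompat e he (fun a _ ha => hcov' a ha) hpre hPproj ν hme
    (fun g hg => by
      obtain ⟨k, hkθ, hkρ⟩ := hcov' g hg
      exact ⟨k, (Subgroup.mem_inf.mp (RD.lDeltaTheta_le hkθ)).2, hkρ⟩)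
    hconst hreach hLc hLi hproj

end OfConnectedTemperoidData

end ThetaFrobenioid

end Literature.AnabelianGeometry.EtaleTheta

end
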